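import Literature.AlgebraicGeometry.Resolution.AlterationsNormalFormBlowupParts
import HarnessLib

/-!
# [OURS · L1 W4.2] D8-S1 infrastructure, file 1: irreducible components of a subset UNDER AN OPEN EMBEDDING (traces)
# (crux chain w42, v7 stub `stub_isoOpenRestartLocal` ⟸ `LocalRunSimulationM p`, p513760; hand res-D-pv-060)

OURS plumbing (cell `res-hironaka`, slot W4.2, crux `stmt-ResolutionOfSingularities-18506` / conjunct `-19249`; `--supports … --as helper`,
counted 0); pure topology about the tree's `Literature.AlgebraicGeometry.Resolution.componentsIn`; NOT statements of the manuscript under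
review [claim: Hironaka2017, status: under-review] nor of [CossartJannsenSaito2020]. AI plumbing, weaker than expert review.

First brick of the proof of the run-level Zariski localisation `LocalRunSimulationM` (D8-S1 DESIGN §1 (S-c), §3 «MISSING»): along an open
embedding `f` (the open immersions `ι m` of the simulation), the irreducible components of `f ⁻¹' S` are exactly the preimages of the
components of `S` that meet the range of `f` — the dictionary through which the LABELS of the `ν`-strata (`Labelling.part`, read on
`componentsIn`) are compared between the global run and the run of the pointed open.

* `IsPreirreducible.of_subset_of_subset_closure` — a set sandwiched between a preirreducible set and its closure is preirreducible;
* `preimage_mem_componentsIn_of_isOpenEmbedding` — `E ∈ componentsIn S`, `E` meets `range f` ⇒ `f ⁻¹' E ∈ componentsIn (f ⁻¹' S)`;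
* `componentsIn_exists_superset` — every irreducible subset of `S` lies in a component of `S`;
* `exists_mem_componentsIn_preimage_eq` — every component of `f ⁻¹' S` is such a preimage.
[folklore]
-/

set_option linter.dupNamespace false -- mandated namespace of this single-conjunct summit

open Topology TopologicalSpace Set

universe u v

namespace Summit.ResolutionOfSingularities.ResolutionOfSingularities.Theorems.CampaignW42

open Literature.AlgebraicGeometry.Resolution

variable {X : Type u} {Y : Type v} [TopologicalSpace X] [TopologicalSpace Y]

/-- **A set sandwiched between a preirreducible set and its closure is preirreducible.** [folklore] -/
theorem IsPreirreducible.of_subset_of_subset_closure {B W : Set Y} (hB : IsPreirreducible B) (hBW : B ⊆ W)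
    (hW : W ⊆ closure B) : IsPreirreducible W := by
  intro u v hu hv ⟨x, hxW, hxu⟩ ⟨y, hyW, hyv⟩
  have hBu : (B ∩ u).Nonempty := by
    have := mem_closure_iff.mp (hW hxW) u hu hxu
    obtain ⟨z, hzu, hzB⟩ := this
    exact ⟨z, hzB, hzu⟩
  have hBv : (B ∩ v).Nonempty := by
    obtain ⟨z, hzv, hzB⟩ := mem_closure_iff.mp (hW hyW) v hv hyv
    exact ⟨z, hzB, hzv⟩
  obtain ⟨z, hzB, hz⟩ := hB u v hu hv hBu hBv
  exact ⟨z, hBW hzB, hz⟩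

/-- **Components of a subset pull back along an open embedding**: if `E` is an irreducible component of `S ⊆ Y` meeting the range of
the open embedding `f : X → Y`, then `f ⁻¹' E` is an irreducible component of `f ⁻¹' S`. [folklore] -/
theorem preimage_mem_componentsIn_of_isOpenEmbedding {f : X → Y} (hf : IsOpenEmbedding f) {S E : Set Y}
    (hE : E ∈ componentsIn S) (hne : (E ∩ range f).Nonempty) : f ⁻¹' E ∈ componentsIn (f ⁻¹' S) := by
  rw [mem_componentsIn_iff] at hE ⊢
  obtain ⟨hES, hEirr, hEmax⟩ := hE
  refine ⟨preimage_mono hES, hEirr.preimage hf hne, fun T hTS hT hET => ?_⟩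
  -- `f '' T` is irreducible in `S` and contains the dense open part `E ∩ range f` of `E`
  have hfT : IsIrreducible (f '' T) := hT.image f hf.continuous.continuousOn
  have hsub : E ∩ range f ⊆ f '' T := by
    rintro _ ⟨hyE, x, rfl⟩
    exact ⟨x, hET hyE, rfl⟩
  -- `E ⊆ closure (f '' T)`: the non-empty open part `E ∩ range f` is dense in the irreducible `E`
  have hEcl : E ⊆ closure (f '' T) := by
    have hdense : E ⊆ closure (E ∩ range f) :=
      subset_closure_inter_of_isPreirreducible_of_isOpen hEirr.2 hf.isOpen_range hne
    exact hdense.trans (closure_mono hsub)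
  -- the sandwich `f '' T ⊆ W := (E ∪ f '' T) ⊆ closure (f '' T)` is irreducible inside `S`, contains `E`, hence equals `E`
  set W : Set Y := E ∪ f '' T with hWdef
  have hWirr : IsIrreducible W :=
    ⟨hfT.1.mono subset_union_right,
      IsPreirreducible.of_subset_of_subset_closure hfT.2 subset_union_right
        (union_subset hEcl subset_closure)⟩
  have hWS : W ⊆ S := union_subset hES (image_subset_iff.mpr hTS)
  have hWE : W ⊆ E := hEmax W hWS hWirr subset_union_left
  intro x hx
  exact hWE (subset_union_right ⟨x, hx, rfl⟩)

/-- **A (pre)irreducible subset of `S` pulled back to the subspace `↥S` is preirreducible** (opens of the subspace are traces of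
opens). [folklore] -/
theorem isPreirreducible_preimage_val {S A : Set Y} (hA : IsPreirreducible A) (hAS : A ⊆ S) :
    IsPreirreducible (((↑) : S → Y) ⁻¹' A) := by
  intro u' v' hu' hv' ⟨x, hxA, hxu⟩ ⟨y, hyA, hyv⟩
  obtain ⟨u, hu, rfl⟩ := (Topology.IsInducing.subtypeVal.isOpen_iff).mp hu'
  obtain ⟨v, hv, rfl⟩ := (Topology.IsInducing.subtypeVal.isOpen_iff).mp hv'
  obtain ⟨z, hzA, hzu, hzv⟩ := hA u v hu hv ⟨x, hxA, hxu⟩ ⟨y, hyA, hyv⟩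
  exact ⟨⟨z, hAS hzA⟩, hzA, hzu, hzv⟩

/-- **Every irreducible subset of `S` lies in an irreducible component of `S`.** [folklore] -/
theorem componentsIn_exists_superset {S A : Set Y} (hAS : A ⊆ S) (hA : IsIrreducible A) :
    ∃ E ∈ componentsIn S, A ⊆ E := by
  obtain ⟨t, ht, hAt, htmax⟩ := exists_preirreducible _ (isPreirreducible_preimage_val hA.2 hAS)
  obtain ⟨a, ha⟩ := hA.1
  have htne : t.Nonempty := ⟨⟨a, hAS ha⟩, hAt ha⟩
  have htirr : IsIrreducible t := ⟨htne, ht⟩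
  have hmax : t ∈ irreducibleComponents S := by
    refine ⟨htirr, fun u hu htu => ?_⟩
    rw [htmax u hu.2 htu]
  refine ⟨_, componentsIn.image_val_mem hmax, fun x hx => ⟨⟨x, hAS hx⟩, hAt hx, rfl⟩⟩

/-- **Every component of `f ⁻¹' S` is the preimage of a component of `S` meeting the range** (the component of `S` containing its
image). [folklore] -/
theorem exists_mem_componentsIn_preimage_eq {f : X → Y} (hf : IsOpenEmbedding f) {S : Set Y} {E' : Set X}
    (hE' : E' ∈ componentsIn (f ⁻¹' S)) :
    ∃ E ∈ componentsIn S, (E ∩ range f).Nonempty ∧ f ⁻¹' E = E' := by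
  have hE'irr := componentsIn.isIrreducible hE'
  have hfE' : IsIrreducible (f '' E') := hE'irr.image f hf.continuous.continuousOn
  have hfE'S : f '' E' ⊆ S := image_subset_iff.mpr (componentsIn.subset hE')
  obtain ⟨E, hE, hsub⟩ := componentsIn_exists_superset hfE'S hfE'
  obtain ⟨x, hx⟩ := hE'irr.1
  have hne : (E ∩ range f).Nonempty := ⟨f x, hsub ⟨x, hx, rfl⟩, x, rfl⟩
  refine ⟨E, hE, hne, ?_⟩
  have hpre := preimage_mem_componentsIn_of_isOpenEmbedding hf hE hne
  have hE'sub : E' ⊆ f ⁻¹' E := fun x hx => hsub ⟨x, hx, rfl⟩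
  exact Subset.antisymm
    ((mem_componentsIn_iff.mp hE').2.2 _ (componentsIn.subset hpre) (componentsIn.isIrreducible hpre) hE'sub) hE'sub

end Summit.ResolutionOfSingularities.ResolutionOfSingularities.Theorems.CampaignW42
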